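import Summits.ABC.ABC.Theses.IsogenyGlueCongruence
import Summits.ABC.ABC.Theorems.IsogenyGlueCongruenceSharpDegreeOfPolyDegreeValuation
import Summits.ABC.ABC.Theorems.IsogenyGlueCongruenceSharpDegreeOfPolyDegreeOptimalComparison
import Summits.ABC.ABC.Theorems.XiBound.Negative.XiBoundTakahashiSqueeze
import Literature.NumberTheory.DiophantineGeometry.PastenValuationProductsProofs
import Literature.NumberTheory.Automorphic.BrandtXi

set_option linter.dupNamespace false

/-!
# Crux `SharpDegreeOfPolyDegree` (stmt-ABC-10895), line `Sketch`: the residual stub is R-complete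

`R := SharpDegreeOfPolyDegree = (Poly → X)`.  The line's skeleton
(`Cruxes/SharpDegreeOfPolyDegree/Lines/Sketch.lean`) proves `R` from its residual stub
`stub_xiSharpUnderPoly` (C⁺: under Poly, `ξ(E; N/q, q) ≤ C_ε N^{2+ε}` for every semistable `E` in
global minimal form and every odd prime `q ∣ N`), the landed stubs L0 / OC / TB and the two named
facts `takahashi2001_thm_2_3`, `PastenShimura2024_minimalDegree_le_163_mul`.  This support file
(lands `--supports stmt-ABC-10895`) proves the CONVERSE, registered as the stub
`stub_xiSharpOfSharp`: granted `takahashi2001_thm_2_3` alone, `R` implies C⁺.  So, modulo the two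
named facts, C⁺ ⟺ R: the residual stub is an exact relocation of the crux to the definite side
(Takahashi's identity `δ · i = ξ · j` read backwards), and carries its full abc-strength — which is
what the card `oldforms-free-under-poly` and the three triage reports state informally.

Proof (`stub_xiSharpOfSharp`): under Poly, `R` gives `X`; fix `ε`, take `C_X` from `X` at `ε/2` and
`A` from L0 (`stub_valuationLogBound`).  For `W` and an odd prime `q ∣ N`: `X` supplies a datum `D_X`
of `W` with `deg ≤ C_X N^{2+ε/2}`; `exists_optimalDatum'` supplies an optimal datum `D₀` of a curve
`W₀` with the same newform, of minimal degree in the class (`modularDegree_le_of_isogenyMap_ker_eq_bot`),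
so `deg D₀ ≤ deg D_X`; `W₀` has the same `a`-sequence and squarefree conductor `= N`
(`lFunction_eq_of_f_eq`, `squarefree_conductorNorm_of_f_eq`,
`IsNewformOf.level_eq_conductorNorm_of_squarefree`), hence is semistable.  Takahashi at `W₀`
(`XiBound.Negative.brandtXi_le_modularDegree_mul_ord`, landed: `ξ · j = δ₀ · i`,
`i j = v_q(Δ_min W₀)`, `δ₀, i ≥ 1` force `j ≥ 1`, so `ξ ≤ δ₀ · v_q(Δ_min W₀)`), and L0 at `W₀` (`v_q log q ≤ A log N + A`, `log q ≥ 1`) give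
`ξ ≤ C_X N^{2+ε/2} · max(A,0) (2/ε + 1) N^{ε/2}`.

Theorems only (no definition, no named fact).
-/

noncomputable section

namespace Summit.ABC.ABC.Theorems.SharpDegreeOfPolyDegree

open Summit.ABC.ABC.Theses.IsogenyGlueCongruence
open Literature.NumberTheory.EllipticCurves Literature.NumberTheory.EllipticCurves.ModularForms
open Literature.NumberTheory.DiophantineGeometry Literature.NumberTheory.Automorphic
open WeierstrassCurve

/-! ## Takahashi's identity read backwards: `ξ ≤ δ · v_q` -/

/-- **`ξ(E; L/q, q) ≤ δ · ord_q Δ_min(E)` at the optimal curve** (Takahashi 2001, Thm. 2.3 read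
backwards: `δ i = ξ j`, `i j = ord_q Δ_min`, `i, δ ≥ 1` force `j ≥ 1`): the landed product-level form
`Summit.ABC.ABC.Theorems.XiBound.Negative.brandtXi_le_modularDegree_mul_ord` with the level a
variable `L = N_{W₀}` squarefree and `q ∣ L` prime (substitute `L = (L/q) · q`).
[cite: Takahashi2001, Thm. 2.3] -/
theorem brandtXi_le_modularDegree_mul (hT : takahashi2001_thm_2_3)
    (W₀ : WeierstrassCurve ℚ) [W₀.IsElliptic] (L : ℕ) [NeZero L] (hN : W₀.conductorNorm ℤ = L)
    (hsq : Squarefree L) (q : ℕ) (hq : q.Prime) (hqL : q ∣ L)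
    (D₀ : ModularParametrizationData W₀ L)
    (hmin : ∀ (W' : WeierstrassCurve ℚ) [W'.IsElliptic] (D' : ModularParametrizationData W' L),
      D'.f = D₀.f → D₀.modularDegree ≤ D'.modularDegree) :
    brandtXi (L / q) q (fun n => W₀.LFunction n) ≤
      D₀.modularDegree * (W₀.minimalDiscriminantNorm ℤ).factorization q := by
  revert D₀
  obtain ⟨M, rfl⟩ : ∃ M, L = M * q := ⟨L / q, (Nat.div_mul_cancel hqL).symm⟩
  intro D₀ hmin
  rw [Nat.mul_div_cancel M hq.pos]
  exact XiBound.Negative.brandtXi_le_modularDegree_mul_ord hT W₀ M q hq hsq hN D₀ hmin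

/-! ## Elementary real-analysis helpers -/

/-- `log q ≥ 1` for an odd prime `q` (`q ≥ 3 > e`). [folklore] -/
theorem one_le_log_of_odd_prime {q : ℕ} (hq : q.Prime) (hq2 : q ≠ 2) : (1 : ℝ) ≤ Real.log q := by
  have hq3 : (3 : ℝ) ≤ q := by
    have h2 := hq.two_le
    have : 3 ≤ q := by omega
    exact_mod_cast this
  have hqpos : (0 : ℝ) < q := by linarith
  rw [Real.le_log_iff_exp_le hqpos]
  have := Real.exp_one_lt_d9
  linarith

/-- `log N + 1 ≤ (1/η + 1) · N^η` for `N ≥ 1`, `η > 0` (`log N ≤ N^η/η`). [folklore] -/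
theorem log_add_one_le {N η : ℝ} (hN : 1 ≤ N) (hη : 0 < η) :
    Real.log N + 1 ≤ (1 / η + 1) * N ^ η := by
  have h1 : Real.log N ≤ N ^ η / η := Real.log_le_rpow_div (by linarith) hη
  have h2 : (1 : ℝ) ≤ N ^ η := Real.one_le_rpow hN hη.le
  have h3 : N ^ η / η = 1 / η * N ^ η := by
    field_simp
  rw [h3] at h1
  nlinarith

/-! ## The converse certificate -/

/-- **R-completeness of the residual stub (registered stub `stub_xiSharpOfSharp`)**: granted
`takahashi2001_thm_2_3`, the crux `R = SharpDegreeOfPolyDegree` implies C⁺ — under Poly, for every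
`ε > 0` there is `C` with `ξ(E; N/q, q) ≤ C N^{2+ε}` for every semistable `E/ℚ` in global minimal
form and every odd prime `q ∣ N`.  With the skeleton's direction (C⁺ + facts ⟹ R) this makes C⁺
equivalent to `R` modulo the named facts: the stub is exactly crux-sized.  Proof in the module
docstring. [cite: Takahashi2001, Thm. 2.3] [cite: MurtyCongruencePrimes1999, Thm. 1] -/
theorem stub_xiSharpOfSharp :
    takahashi2001_thm_2_3 → SharpDegreeOfPolyDegree →
    (∃ κ C : ℝ, ∀ (W : WeierstrassCurve ℚ) [W.IsElliptic] [W.IsGloballyMinimal]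
      [NeZero (W.conductorNorm ℤ)], W.IsSemistable ℤ →
        ∃ D : ModularParametrizationData W (W.conductorNorm ℤ),
          (D.modularDegree : ℝ) ≤ C * (W.conductorNorm ℤ : ℝ) ^ κ) →
    ∀ ε : ℝ, 0 < ε → ∃ C : ℝ, ∀ (W : WeierstrassCurve ℚ) [W.IsElliptic] [W.IsGloballyMinimal]
      [NeZero (W.conductorNorm ℤ)], W.IsSemistable ℤ → ∀ q : ℕ, q.Prime → q ≠ 2 →
        q ∣ W.conductorNorm ℤ →
          (brandtXi (W.conductorNorm ℤ / q) q (fun n => W.LFunction n) : ℝ) ≤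
            C * (W.conductorNorm ℤ : ℝ) ^ (2 + ε) := by
  intro hT hR hPoly ε hε
  have hX : SemistableDegreeConjecture := hR hPoly
  have hε2 : 0 < ε / 2 := by positivity
  obtain ⟨CX, hCX⟩ := hX (ε / 2) hε2
  obtain ⟨A, hA⟩ := stub_valuationLogBound hPoly
  refine ⟨max CX 0 * (max A 0 * (1 / (ε / 2) + 1)), ?_⟩
  intro W _ _ _ hss q hq hq2 hqN
  have hNpos : 0 < W.conductorNorm ℤ := Nat.pos_of_ne_zero (NeZero.ne _)
  have hN1 : (1 : ℝ) ≤ (W.conductorNorm ℤ : ℝ) := by exact_mod_cast hNpos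
  have hN0 : (0 : ℝ) < (W.conductorNorm ℤ : ℝ) := by linarith
  -- the datum supplied by `X`
  obtain ⟨DX, hDX⟩ := hCX W hss
  -- an optimal datum `D₀` with newform `DX.f`, of minimal degree in the class
  obtain ⟨W₀, hW₀, D₀, hf₀, h₀⟩ := DX.exists_optimalDatum'
  haveI := hW₀
  have hker₀ : D₀.isogenyMap.ker = ⊥ := D₀.isogenyMap_ker_eq_bot_iff.mpr h₀
  have hmin₀ : ∀ (W' : WeierstrassCurve ℚ) [W'.IsElliptic]
      (D' : ModularParametrizationData W' (W.conductorNorm ℤ)), D'.f = D₀.f →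
        D₀.modularDegree ≤ D'.modularDegree := fun W' _ D' hD' ↦
    D₀.modularDegree_le_of_isogenyMap_ker_eq_bot hker₀ D' hD'
  have hδ : D₀.modularDegree ≤ DX.modularDegree := hmin₀ W DX hf₀.symm
  -- `W₀`: same `a`-sequence, squarefree conductor `= N`, semistable
  have hsq : Squarefree (W.conductorNorm ℤ) := (W.isSemistable_iff_squarefree_conductorNorm).mp hss
  have hsq₀ : Squarefree (W₀.conductorNorm ℤ) := squarefree_conductorNorm_of_f_eq D₀ DX hf₀ hsq
  have hN₀ : W.conductorNorm ℤ = W₀.conductorNorm ℤ :=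
    D₀.isNewformOf.level_eq_conductorNorm_of_squarefree hsq₀
  have hss₀ : W₀.IsSemistable ℤ := (W₀.isSemistable_iff_squarefree_conductorNorm).mpr hsq₀
  have ha : (fun n => W₀.LFunction n) = (fun n => W.LFunction n) :=
    funext (lFunction_eq_of_f_eq D₀ DX hf₀)
  -- Takahashi at `W₀`: `ξ ≤ δ₀ · v_q(Δ_min W₀)`
  have hTB := brandtXi_le_modularDegree_mul hT W₀ (W.conductorNorm ℤ) hN₀.symm hsq q hq hqN D₀ hmin₀
  rw [ha] at hTB
  -- L0 at `W₀`
  have h3 := hA W₀ hss₀ q hq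
  rw [← hN₀] at h3
  -- abbreviations
  set N : ℝ := (W.conductorNorm ℤ : ℝ) with hNdef
  set ξ : ℝ := (brandtXi (W.conductorNorm ℤ / q) q (fun n => W.LFunction n) : ℝ) with hξ
  set v : ℝ := (((W₀.minimalDiscriminantNorm ℤ).factorization q : ℕ) : ℝ) with hv
  have hv0 : 0 ≤ v := by rw [hv]; exact Nat.cast_nonneg _
  have hNb : 0 ≤ N ^ (2 + ε / 2) := Real.rpow_nonneg hN0.le _
  -- `ξ ≤ deg DX · v`
  have h1 : ξ ≤ (DX.modularDegree : ℝ) * v := by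
    have h1' : ξ ≤ (D₀.modularDegree : ℝ) * v := by rw [hξ, hv]; exact_mod_cast hTB
    have h1'' : (D₀.modularDegree : ℝ) ≤ (DX.modularDegree : ℝ) := by exact_mod_cast hδ
    exact h1'.trans (mul_le_mul_of_nonneg_right h1'' hv0)
  -- `deg DX ≤ max CX 0 · N^{2+ε/2}`
  have h2 : (DX.modularDegree : ℝ) ≤ max CX 0 * N ^ (2 + ε / 2) :=
    hDX.trans (mul_le_mul_of_nonneg_right (le_max_left _ _) hNb)
  -- `v ≤ max A 0 · (1/(ε/2) + 1) · N^{ε/2}`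
  have hlog1 : (1 : ℝ) ≤ Real.log q := one_le_log_of_odd_prime hq hq2
  have hlogN : 0 ≤ Real.log N := Real.log_nonneg hN1
  have hv1 : v ≤ max A 0 * ((1 / (ε / 2) + 1) * N ^ (ε / 2)) := by
    calc v ≤ v * Real.log q := le_mul_of_one_le_right hv0 hlog1
      _ ≤ A * Real.log N + A := h3
      _ ≤ max A 0 * Real.log N + max A 0 :=
          add_le_add (mul_le_mul_of_nonneg_right (le_max_left _ _) hlogN) (le_max_left _ _)
      _ = max A 0 * (Real.log N + 1) := by ring
      _ ≤ max A 0 * ((1 / (ε / 2) + 1) * N ^ (ε / 2)) :=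
          mul_le_mul_of_nonneg_left (log_add_one_le hN1 hε2) (le_max_right _ _)
  -- exponents
  have hexp : N ^ (2 + ε / 2) * N ^ (ε / 2) = N ^ (2 + ε) := by
    rw [← Real.rpow_add hN0]
    ring_nf
  have hdeg0 : 0 ≤ (DX.modularDegree : ℝ) := Nat.cast_nonneg _
  calc ξ ≤ (DX.modularDegree : ℝ) * v := h1
    _ ≤ (max CX 0 * N ^ (2 + ε / 2)) * (max A 0 * ((1 / (ε / 2) + 1) * N ^ (ε / 2))) :=
        mul_le_mul h2 hv1 hv0 (le_trans hdeg0 h2)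
    _ = max CX 0 * (max A 0 * (1 / (ε / 2) + 1)) * (N ^ (2 + ε / 2) * N ^ (ε / 2)) := by ring
    _ = max CX 0 * (max A 0 * (1 / (ε / 2) + 1)) * N ^ (2 + ε) := by rw [hexp]

/-! ## The a-priori bound: under Poly alone, `ξ` is polynomial -/

/-- **Transfer core: any datum bounds `ξ` at the optimal curve.** Granted `takahashi2001_thm_2_3`,
for a semistable `W/ℚ`, a datum `DX` of `W` at level `N_W` and a prime `q ∣ N_W`, there is a curve
`W₀` of the class (the optimal one: `exists_optimalDatum'`, minimal degree in the class), semistable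
and of the same conductor, with `ξ(W; N/q, q) ≤ deg DX · ord_q Δ_min(W₀)` — Takahashi's identity read
backwards at `W₀` (`brandtXi_le_modularDegree_mul`) and `deg D₀ ≤ deg DX`, `a(W₀) = a(W)`.
[cite: Takahashi2001, Thm. 2.3] -/
theorem exists_brandtXi_le_modularDegree_mul (hT : takahashi2001_thm_2_3)
    (W : WeierstrassCurve ℚ) [W.IsElliptic] [NeZero (W.conductorNorm ℤ)] (hss : W.IsSemistable ℤ)
    (DX : ModularParametrizationData W (W.conductorNorm ℤ)) {q : ℕ} (hq : q.Prime)
    (hqN : q ∣ W.conductorNorm ℤ) :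
    ∃ (W₀ : WeierstrassCurve ℚ) (_ : W₀.IsElliptic), W₀.IsSemistable ℤ ∧
      W₀.conductorNorm ℤ = W.conductorNorm ℤ ∧
      brandtXi (W.conductorNorm ℤ / q) q (fun n => W.LFunction n) ≤
        DX.modularDegree * (W₀.minimalDiscriminantNorm ℤ).factorization q := by
  obtain ⟨W₀, hW₀, D₀, hf₀, h₀⟩ := DX.exists_optimalDatum'
  haveI := hW₀
  have hker₀ : D₀.isogenyMap.ker = ⊥ := D₀.isogenyMap_ker_eq_bot_iff.mpr h₀
  have hmin₀ : ∀ (W' : WeierstrassCurve ℚ) [W'.IsElliptic]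
      (D' : ModularParametrizationData W' (W.conductorNorm ℤ)), D'.f = D₀.f →
        D₀.modularDegree ≤ D'.modularDegree := fun W' _ D' hD' ↦
    D₀.modularDegree_le_of_isogenyMap_ker_eq_bot hker₀ D' hD'
  have hδ : D₀.modularDegree ≤ DX.modularDegree := hmin₀ W DX hf₀.symm
  have hsq : Squarefree (W.conductorNorm ℤ) := (W.isSemistable_iff_squarefree_conductorNorm).mp hss
  have hsq₀ : Squarefree (W₀.conductorNorm ℤ) := squarefree_conductorNorm_of_f_eq D₀ DX hf₀ hsq
  have hN₀ : W.conductorNorm ℤ = W₀.conductorNorm ℤ :=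
    D₀.isNewformOf.level_eq_conductorNorm_of_squarefree hsq₀
  have ha : (fun n => W₀.LFunction n) = (fun n => W.LFunction n) :=
    funext (lFunction_eq_of_f_eq D₀ DX hf₀)
  have hTB := brandtXi_le_modularDegree_mul hT W₀ (W.conductorNorm ℤ) hN₀.symm hsq q hq hqN D₀ hmin₀
  rw [ha] at hTB
  exact ⟨W₀, hW₀, (W₀.isSemistable_iff_squarefree_conductorNorm).mpr hsq₀, hN₀.symm,
    hTB.trans (Nat.mul_le_mul_right _ hδ)⟩

/-- **Under Poly alone, `ξ` is polynomially bounded** (the a-priori height bound of the rational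
Hecke eigenline in the Brandt module, handle (2) of the card `oldforms-free-under-poly`): granted
`takahashi2001_thm_2_3`, the polynomial modular-degree bound gives `κ', C'` with
`ξ(E; N/q, q) ≤ C' N^{κ'}` for every semistable `E/ℚ` in global minimal form and every odd prime
`q ∣ N` (`κ' = κ + 1`: `ξ ≤ deg D_P · v_q ≤ C N^κ · (A log N + A) ≤ 2 max(C,0) max(A,0) N^{κ+1}`).
So the residual C⁺ asks to improve a polynomial exponent to `2 + ε` — the whole abc-strength of `R`.
[cite: Takahashi2001, Thm. 2.3] -/
theorem brandtXi_polyBound_of_polyDegree (hT : takahashi2001_thm_2_3)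
    (hPoly : ∃ κ C : ℝ, ∀ (W : WeierstrassCurve ℚ) [W.IsElliptic] [W.IsGloballyMinimal]
      [NeZero (W.conductorNorm ℤ)], W.IsSemistable ℤ →
        ∃ D : ModularParametrizationData W (W.conductorNorm ℤ),
          (D.modularDegree : ℝ) ≤ C * (W.conductorNorm ℤ : ℝ) ^ κ) :
    ∃ κ' C' : ℝ, ∀ (W : WeierstrassCurve ℚ) [W.IsElliptic] [W.IsGloballyMinimal]
      [NeZero (W.conductorNorm ℤ)], W.IsSemistable ℤ → ∀ q : ℕ, q.Prime → q ≠ 2 →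
        q ∣ W.conductorNorm ℤ →
          (brandtXi (W.conductorNorm ℤ / q) q (fun n => W.LFunction n) : ℝ) ≤
            C' * (W.conductorNorm ℤ : ℝ) ^ κ' := by
  obtain ⟨A, hA⟩ := stub_valuationLogBound hPoly
  obtain ⟨κ, C, hC⟩ := hPoly
  refine ⟨κ + 1, max C 0 * (max A 0 * 2), ?_⟩
  intro W _ _ _ hss q hq hq2 hqN
  have hNpos : 0 < W.conductorNorm ℤ := Nat.pos_of_ne_zero (NeZero.ne _)
  have hN1 : (1 : ℝ) ≤ (W.conductorNorm ℤ : ℝ) := by exact_mod_cast hNpos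
  have hN0 : (0 : ℝ) < (W.conductorNorm ℤ : ℝ) := by linarith
  obtain ⟨DP, hDP⟩ := hC W hss
  obtain ⟨W₀, hW₀, hss₀, hN₀, hle⟩ := exists_brandtXi_le_modularDegree_mul hT W hss DP hq hqN
  haveI := hW₀
  have h3 := hA W₀ hss₀ q hq
  rw [hN₀] at h3
  set N : ℝ := (W.conductorNorm ℤ : ℝ) with hNdef
  set v : ℝ := (((W₀.minimalDiscriminantNorm ℤ).factorization q : ℕ) : ℝ) with hv
  have hv0 : 0 ≤ v := by rw [hv]; exact Nat.cast_nonneg _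
  have hNκ : 0 ≤ N ^ κ := Real.rpow_nonneg hN0.le _
  have h1 : (brandtXi (W.conductorNorm ℤ / q) q (fun n => W.LFunction n) : ℝ) ≤
      (DP.modularDegree : ℝ) * v := by rw [hv]; exact_mod_cast hle
  have h2 : (DP.modularDegree : ℝ) ≤ max C 0 * N ^ κ :=
    hDP.trans (mul_le_mul_of_nonneg_right (le_max_left _ _) hNκ)
  have hlog1 : (1 : ℝ) ≤ Real.log q := one_le_log_of_odd_prime hq hq2
  have hlogN : 0 ≤ Real.log N := Real.log_nonneg hN1
  have hv1 : v ≤ max A 0 * (2 * N ^ (1 : ℝ)) := by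
    have hl : Real.log N + 1 ≤ (1 / 1 + 1) * N ^ (1 : ℝ) := log_add_one_le hN1 one_pos
    calc v ≤ v * Real.log q := le_mul_of_one_le_right hv0 hlog1
      _ ≤ A * Real.log N + A := h3
      _ ≤ max A 0 * Real.log N + max A 0 :=
          add_le_add (mul_le_mul_of_nonneg_right (le_max_left _ _) hlogN) (le_max_left _ _)
      _ = max A 0 * (Real.log N + 1) := by ring
      _ ≤ max A 0 * (2 * N ^ (1 : ℝ)) :=
          mul_le_mul_of_nonneg_left (by norm_num at hl ⊢; linarith) (le_max_right _ _)
  have hexp : N ^ κ * N ^ (1 : ℝ) = N ^ (κ + 1) := by rw [← Real.rpow_add hN0]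
  have hdeg0 : 0 ≤ (DP.modularDegree : ℝ) := Nat.cast_nonneg _
  calc (brandtXi (W.conductorNorm ℤ / q) q (fun n => W.LFunction n) : ℝ)
        ≤ (DP.modularDegree : ℝ) * v := h1
    _ ≤ (max C 0 * N ^ κ) * (max A 0 * (2 * N ^ (1 : ℝ))) :=
        mul_le_mul h2 hv1 hv0 (le_trans hdeg0 h2)
    _ = max C 0 * (max A 0 * 2) * (N ^ κ * N ^ (1 : ℝ)) := by ring
    _ = max C 0 * (max A 0 * 2) * N ^ (κ + 1) := by rw [hexp]

end Summit.ABC.ABC.Theorems.SharpDegreeOfPolyDegree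

end
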